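import Literature.AlgebraicGeometry.Resolution.DecompositionFieldCoarsening
import Mathlib.FieldTheory.Galois.Basic
import Mathlib.RingTheory.Valuation.RamificationGroup
import HarnessLib

/-!
# First-order approximation in the decomposition field (Kuhlmann 2011, Thm. 1.1)

Topic: `Literature/AlgebraicGeometry/Resolution` (valued function fields). Final step of the
proof (files `ValuationOverrings.lean`, `ValuationAlgebraicExtension.lean`,
`DecompositionFieldCoarsening.lean`, this file) of

* `decompositionField_approx` — **for a finite Galois extension `N | K`, a valuation subring
  `W` of `N` with decomposition group `D(W) = {σ : σ • W = W}` and decomposition field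
  `Z = N^{D(W)}`, every non-zero `a ∈ Z` is approximated to first order by an element of `K`:
  there is `c ∈ K` with `|a - c|_W < |a|_W`.** PROVED.

This is the finite-level content of F.-V. Kuhlmann, *Approximation of elements in
henselizations*, Manuscripta Math. 136 (2011), Thm. 1.1 ("Every element `a ∈ K^h ∖ K` is weakly
distinguished over `K`. In particular, the henselization is an immediate extension of
`(K,v)`"; by Lemma 3.2/§3 there, weakly distinguished elements `z` satisfy
`∀ c ∃ c', v(z - c') > v(z - c)`, whence with `c = 0` our statement), and it yields at once
that `(Z, W ∩ Z) | (K, W ∩ K)` is IMMEDIATE (`|a| = |c|`; for `|a| ≤ 1`, `a ≡ c mod 𝔪_W`) —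
Kuhlmann 2010, Lemma 2.2 (`Kuhlmann2010HenselizationImmediate`, assembled in
`HenselizationImmediateProofs.lean`).

## Proof (induction on the decomposition group, Kuhlmann 2011 §4 after Zariski–Samuel)

By induction on `|Gal(N|K)| - |D(W)|`. If `D(W) = Gal(N|K)` then `a ∈ K` (Galois theory).
Otherwise let `W < W'` be the least coarsening with `D(W) < D(W')`
(`exists_coarsening_stabilizer_lt`), `G' = D(W')`.

* `exists_fixed_valuation_sub_lt` — there is `c' ∈ N^{G'}` with `|a - c'|_W < |a|_W`: the
  ratios `σ a / a` (`σ ∈ G'`) are `W'`-units (`valuation_smul_eq`); with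
  `x` small at `W` and larger than all of them at every conjugate `τ • W ≠ W`, `τ ∈ G'`
  (`exists_valuation_lt_one_forall_lt_valuation_smul`), the norm `n = ∏_{h ∈ D(W)} h x` is
  `D(W)`-invariant, small at `W` and large at these conjugates; then `y = a / (1 + n)` has
  `|y - a|_W < |a|_W` and `|g y|_W < |a|_W` for `g ∈ G' ∖ D(W)`, so the `G'`-orbit sum
  `c' = Σ_{z ∈ G' y} z` works (the trace argument of Kuhlmann 2011, Lemma 4.1, with the
  approximation theorem replaced by the large-elements lemma).
* By induction (`D(W')` is larger) there is `c ∈ K` with `|c' - c|_{W'} < |c'|_{W'}`; as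
  `𝔪_{W'} ⊆ 𝔪_W` this gives `|c' - c|_W < |c'|_W = |a|_W`, and `|a - c|_W < |a|_W`.

## Sources

* F.-V. Kuhlmann, *Approximation of elements in henselizations*, Manuscripta Math. 136 (2011)
  461–474 = arXiv:1003.5674, Thm. 1.1, Lemma 3.1–3.2, §4 (Lemma 4.1, 4.2, proof of Thm. 1.1).
  [Kuhlmann2011]
* F.-V. Kuhlmann, *Elimination of ramification I*, Trans. AMS 362 (2010), Lemma 2.2.
  [Kuhlmann2010]
* O. Zariski, P. Samuel, *Commutative Algebra* II (1960), Ch. VI §12 (the original induction).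
  [ZariskiSamuel1960]

## Rendering notes

* `D(W)` is `MulAction.stabilizer (N ≃ₐ[K] N) W`, which is Mathlib's
  `ValuationSubring.decompositionSubgroup K W` by definition; the main theorem is stated with
  the latter.
-/

noncomputable section

open scoped Pointwise

namespace Literature.AlgebraicGeometry.Resolution

universe u

variable {K N : Type u} [Field K] [Field N] [Algebra K N] [FiniteDimensional K N]

/-! ### Products over the decomposition group -/

/-- A product of factors `< 1` over a nonempty finset is `< 1`, in the value group of a
valuation. [folklore] -/
theorem prod_lt_one_of_forall_lt_one {Γ : Type*} [LinearOrderedCommGroupWithZero Γ]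
    {ι : Type*} {s : Finset ι} (hs : s.Nonempty) {f : ι → Γ} (hf : ∀ i ∈ s, f i < 1) :
    ∏ i ∈ s, f i < 1 := by
  classical
  obtain ⟨i₀, hi₀⟩ := hs
  rw [← Finset.mul_prod_erase s f hi₀]
  calc f i₀ * ∏ i ∈ s.erase i₀, f i ≤ f i₀ * 1 := by
        gcongr
        exact Finset.prod_le_one' fun i hi => (hf i (Finset.mem_of_mem_erase hi)).le
    _ < 1 := by rw [mul_one]; exact hf i₀ hi₀

/-- A product of factors `> m ≥ 1` over a nonempty finset is `> m`. [folklore] -/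
theorem lt_prod_of_forall_lt {Γ : Type*} [LinearOrderedCommGroupWithZero Γ]
    {ι : Type*} {s : Finset ι} (hs : s.Nonempty) {f : ι → Γ} {m : Γ} (hm : 1 ≤ m)
    (hf : ∀ i ∈ s, m < f i) : m < ∏ i ∈ s, f i := by
  classical
  obtain ⟨i₀, hi₀⟩ := hs
  rw [← Finset.mul_prod_erase s f hi₀]
  calc m < f i₀ := hf i₀ hi₀
    _ ≤ f i₀ * ∏ i ∈ s.erase i₀, f i :=
        le_mul_of_one_le_right' (Finset.one_le_prod' fun i hi =>
          hm.trans (hf i (Finset.mem_of_mem_erase hi)).le)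

/-! ### The approximation step over the least coarsening -/

/-- **The approximation step** (Kuhlmann 2011, §4, Lemma 4.1–4.2 with the large-elements lemma
in place of the approximation theorem). Let `N | K` be finite Galois, `W ≤ W'`, `W ≠ W'`,
valuation subrings of `N` with `D(W) ≤ D(W')` and the key property of
`exists_coarsening_stabilizer_lt`. Then every non-zero `a` fixed by `D(W)` admits `c'` fixed by
`D(W')` with `|a - c'|_W < |a|_W`. [cite: Kuhlmann2011, Lemma 4.1] -/
theorem exists_fixed_valuation_sub_lt (W W' : ValuationSubring N) (hWW' : W ≤ W')
    (hne : W ≠ W')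
    (hHG' : MulAction.stabilizer (N ≃ₐ[K] N) W ≤ MulAction.stabilizer (N ≃ₐ[K] N) W')
    (hkey : ∀ τ : N ≃ₐ[K] N, τ • W ≠ W → ∀ U : ValuationSubring N, W ≤ U → τ • W ≤ U → W' ≤ U)
    {a : N} (ha : ∀ σ ∈ MulAction.stabilizer (N ≃ₐ[K] N) W, σ • a = a) (ha0 : a ≠ 0) :
    ∃ c' : N, (∀ σ ∈ MulAction.stabilizer (N ≃ₐ[K] N) W', σ • c' = c') ∧
      W.valuation (a - c') < W.valuation a := by
  classical
  set G' := MulAction.stabilizer (N ≃ₐ[K] N) W' with hG'_def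
  set H := MulAction.stabilizer (N ≃ₐ[K] N) W with hH_def
  have hG' : ∀ σ ∈ G', σ • W' = W' := fun σ hσ => MulAction.mem_stabilizer_iff.mp hσ
  have hH : ∀ σ ∈ H, σ • W = W := fun σ hσ => MulAction.mem_stabilizer_iff.mp hσ
  have hva : 0 < W.valuation a := (Valuation.pos_iff _).mpr ha0
  -- the ratios `σ a / a`, `σ ∈ G'`, are `W'`-units; `d` dominates them and `1`
  let D : Finset N := insert 1 ((Finset.univ.filter fun σ : N ≃ₐ[K] N => σ ∈ G').image
    fun σ => σ • a / a)
  obtain ⟨d, hdD, hdmax⟩ := Finset.exists_max_image D (fun t => W.valuation t)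
    ⟨1, Finset.mem_insert_self _ _⟩
  have hd1 : 1 ≤ W.valuation d := by
    have := hdmax 1 (Finset.mem_insert_self _ _)
    rwa [map_one] at this
  have hd0 : d ≠ 0 := by
    intro h
    rw [h, map_zero] at hd1
    exact not_lt_of_ge hd1 zero_lt_one
  have hdW' : d ∈ W' := by
    rcases Finset.mem_insert.mp hdD with rfl | h
    · exact W'.one_mem
    · obtain ⟨σ, hσ, rfl⟩ := Finset.mem_image.mp h
      have hσG' : σ ∈ G' := (Finset.mem_filter.mp hσ).2
      exact (smul_div_self_mem (isOfFinOrder_of_finite σ) (hG' σ hσG') ha0).1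
  have hdrat : ∀ σ ∈ G', W.valuation (σ • a / a) ≤ W.valuation d := fun σ hσ =>
    hdmax _ (Finset.mem_insert_of_mem (Finset.mem_image.mpr
      ⟨σ, Finset.mem_filter.mpr ⟨Finset.mem_univ _, hσ⟩, rfl⟩))
  -- the element `x`: small at `W`, larger than `d` at the conjugates `τ • W ≠ W`, `τ ∈ G'`
  let S : Finset (N ≃ₐ[K] N) := Finset.univ.filter fun σ => σ ∈ G' ∧ σ • W ≠ W
  have hS : ∀ σ ∈ S, σ ∈ G' ∧ σ • W ≠ W := fun σ hσ => (Finset.mem_filter.mp hσ).2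
  obtain ⟨x, hxW, hxS⟩ := exists_valuation_lt_one_forall_lt_valuation_smul hWW' hne G' hG'
    hkey S hS hdW' hd0
  -- the norm `n = ∏_{h ∈ H} h x`
  let n : N := ∏ h : H, (h : N ≃ₐ[K] N) • x
  have hnH : ∀ σ ∈ H, σ • n = n := by
    intro σ hσ
    simp only [n, AlgEquiv.smul_def, map_prod]
    exact Fintype.prod_equiv (Equiv.mulLeft (⟨σ, hσ⟩ : H)) _ _ fun h => rfl
  have hxn : W.valuation n < 1 := by
    simp only [n, map_prod]
    exact prod_lt_one_of_forall_lt_one Finset.univ_nonempty fun h _ =>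
      (valuation_smul_lt_one_iff_of_smul_eq (hH _ h.2) x).mpr hxW
  -- `n` is large at the conjugates `τ • W ≠ W`, `τ ∈ G'`
  have hτn : ∀ τ ∈ G', τ • W ≠ W → W.valuation d < W.valuation (τ • n) := by
    intro τ hτ hτW
    have : τ • n = ∏ h : H, (τ * (h : N ≃ₐ[K] N)) • x := by
      simp only [n, AlgEquiv.smul_def, map_prod, AlgEquiv.mul_apply]
    rw [this, map_prod]
    refine lt_prod_of_forall_lt Finset.univ_nonempty hd1 fun h _ => ?_
    have hσS : (τ * (h : N ≃ₐ[K] N))⁻¹ ∈ S := by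
      refine Finset.mem_filter.mpr ⟨Finset.mem_univ _, G'.inv_mem (G'.mul_mem hτ (hHG' h.2)),
        fun heq => hτW ?_⟩
      rw [inv_smul_eq_iff, mul_smul, hH _ h.2] at heq
      exact heq.symm
    have := hxS _ hσS
    rwa [inv_inv] at this
  -- `y = a / (1 + n)`
  have h1n : W.valuation (1 + n) = 1 := Valuation.map_one_add_of_lt _ hxn
  have h1n0 : 1 + n ≠ 0 := fun h => by
    rw [h, map_zero] at h1n
    exact zero_ne_one h1n
  set y : N := a / (1 + n) with hy_def
  have hyH : ∀ σ ∈ H, σ • y = y := by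
    intro σ hσ
    have h1 := ha σ hσ
    have h2 := hnH σ hσ
    rw [AlgEquiv.smul_def] at h1 h2
    simp only [hy_def, AlgEquiv.smul_def, map_div₀, map_add, map_one, h1, h2]
  have hya : W.valuation (y - a) < W.valuation a := by
    have : y - a = -(a * n) / (1 + n) := by
      rw [hy_def]
      field_simp
      ring
    rw [this, map_div₀, Valuation.map_neg, map_mul, h1n, div_one]
    calc W.valuation a * W.valuation n < W.valuation a * 1 := mul_lt_mul_of_pos_left hxn hva
      _ = W.valuation a := mul_one _
  -- the conjugates `g y`, `g ∈ G'`, different from `y` are small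
  have hgy : ∀ g ∈ G', g • y ≠ y → W.valuation (g • y) < W.valuation a := by
    intro g hg hgy
    have hgW : g • W ≠ W := fun h => hgy (hyH g (MulAction.mem_stabilizer_iff.mpr h))
    have hlt := hτn g hg hgW
    have hgn1 : 1 < W.valuation (g • n) := lt_of_le_of_lt hd1 hlt
    have h1gn : W.valuation (1 + g • n) = W.valuation (g • n) :=
      Valuation.map_add_eq_of_lt_right _ (by rwa [map_one])
    have hgn0 : W.valuation (g • n) ≠ 0 := ne_of_gt (lt_trans zero_lt_one hgn1)
    have : g • y = g • a / (1 + g • n) := by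
      simp only [hy_def, AlgEquiv.smul_def, map_div₀, map_add, map_one]
    rw [this, map_div₀, h1gn, div_lt_iff₀ (zero_lt_iff.mpr hgn0)]
    have hr : W.valuation (g • a) = W.valuation (g • a / a) * W.valuation a := by
      rw [← map_mul, div_mul_cancel₀ _ ha0]
    rw [hr]
    calc W.valuation (g • a / a) * W.valuation a ≤ W.valuation d * W.valuation a := by
          gcongr
          exact hdrat g hg
      _ < W.valuation (g • n) * W.valuation a := mul_lt_mul_of_pos_right hlt hva
      _ = W.valuation a * W.valuation (g • n) := mul_comm _ _
  -- the orbit sum `c' = Σ_{z ∈ G' y} z`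
  let O : Finset N := (Finset.univ : Finset G').image fun g : G' => g.1 • y
  have hO : ∀ z, z ∈ O ↔ ∃ g : G', g.1 • y = z := by
    intro z
    simp only [O, Finset.mem_image, Finset.mem_univ, true_and]
  have hyO : y ∈ O := (hO y).mpr ⟨1, one_smul _ _⟩
  refine ⟨∑ z ∈ O, z, fun ρ hρ => ?_, ?_⟩
  · -- `G'`-invariance
    rw [AlgEquiv.smul_def, map_sum]
    refine Finset.sum_equiv (MulAction.toPerm ρ) (fun z => ?_) (fun z _ => rfl)
    rw [MulAction.toPerm_apply, hO, hO]
    constructor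
    · rintro ⟨g, rfl⟩
      exact ⟨⟨ρ, hρ⟩ * g, mul_smul _ _ _⟩
    · rintro ⟨g, hg⟩
      refine ⟨⟨ρ, hρ⟩⁻¹ * g, ?_⟩
      rw [Subgroup.coe_mul, Subgroup.coe_inv, mul_smul, hg, inv_smul_smul]
  · -- the estimate
    have hsplit : ∑ z ∈ O, z - a = (y - a) + ∑ z ∈ O.erase y, z := by
      rw [← Finset.add_sum_erase O (fun z => z) hyO]
      ring
    rw [Valuation.map_sub_swap, hsplit]
    refine Valuation.map_add_lt _ hya (Valuation.map_sum_lt _ (ne_of_gt hva) fun z hz => ?_)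
    obtain ⟨hzy, hzO⟩ := Finset.mem_erase.mp hz
    obtain ⟨g, rfl⟩ := (hO z).mp hzO
    exact hgy g g.2 hzy

/-! ### The theorem -/

/-- **First-order approximation in the decomposition field** (Kuhlmann 2011, Thm. 1.1, finite
level; Kuhlmann 2010, Lemma 2.2). Let `N | K` be a finite Galois extension, `W` a valuation
subring of `N`, and `a ≠ 0` an element of the decomposition field of `W`, i.e. fixed by the
decomposition group `{σ ∈ Gal(N|K) : σ • W = W}` (Mathlib's
`ValuationSubring.decompositionSubgroup`). Then there is `c ∈ K` with `|a - c|_W < |a|_W`.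
Consequently the decomposition field, with the restriction of `W`, is an IMMEDIATE extension
of `(K, W ∩ K)`: `|a|_W = |c|_W` is a value of `K`, and if `|a|_W ≤ 1` then `a ≡ c mod 𝔪_W`
with `c ∈ W ∩ K`. [cite: Kuhlmann2011, Theorem 1.1] -/
theorem decompositionField_approx [IsGalois K N] (W : ValuationSubring N) {a : N}
    (ha : ∀ σ ∈ W.decompositionSubgroup K, σ • a = a) (ha0 : a ≠ 0) :
    ∃ c : K, W.valuation (a - algebraMap K N c) < W.valuation a := by
  classical
  suffices hmain : ∀ (m : ℕ) (W : ValuationSubring N),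
      Nat.card (N ≃ₐ[K] N) - Nat.card (MulAction.stabilizer (N ≃ₐ[K] N) W) = m →
      ∀ a : N, (∀ σ ∈ MulAction.stabilizer (N ≃ₐ[K] N) W, σ • a = a) → a ≠ 0 →
        ∃ c : K, W.valuation (a - algebraMap K N c) < W.valuation a from
    hmain _ W rfl a ha ha0
  intro m
  refine Nat.strong_induction_on m ?_
  intro m ih W hm a ha ha0
  by_cases htop : MulAction.stabilizer (N ≃ₐ[K] N) W = ⊤
  · -- `a` is fixed by the whole Galois group, hence lies in `K`
    have hfix : ∀ f : N ≃ₐ[K] N, f a = a := fun f => ha f (htop ▸ Subgroup.mem_top f)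
    obtain ⟨c, hc⟩ := IntermediateField.mem_bot.mp ((IsGalois.mem_bot_iff_fixed a).mpr hfix)
    refine ⟨c, ?_⟩
    rw [hc, sub_self, map_zero]
    exact (Valuation.pos_iff _).mpr ha0
  · -- pass to the least coarsening `W'` with a larger decomposition group
    obtain ⟨W', hWW', hne, hlt, hkey⟩ :=
      exists_coarsening_stabilizer_lt (G := N ≃ₐ[K] N) W htop
    obtain ⟨c', hc'fix, hc'⟩ := exists_fixed_valuation_sub_lt W W' hWW' hne hlt.le hkey ha ha0
    have hc'0 : c' ≠ 0 := by
      rintro rfl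
      rw [sub_zero] at hc'
      exact lt_irrefl _ hc'
    have hWa : W.valuation c' = W.valuation a :=
      Valuation.map_eq_of_sub_lt _ (by rwa [Valuation.map_sub_swap])
    have hcard : Nat.card (MulAction.stabilizer (N ≃ₐ[K] N) W) <
        Nat.card (MulAction.stabilizer (N ≃ₐ[K] N) W') := by
      by_contra h
      push Not at h
      exact (ne_of_lt hlt) (Subgroup.eq_of_le_of_card_ge hlt.le h)
    have hle' : Nat.card (MulAction.stabilizer (N ≃ₐ[K] N) W') ≤ Nat.card (N ≃ₐ[K] N) :=
      Subgroup.card_le_card_group _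
    obtain ⟨c, hc⟩ := ih (Nat.card (N ≃ₐ[K] N) - Nat.card (MulAction.stabilizer (N ≃ₐ[K] N) W'))
      (by omega) W' rfl c' hc'fix hc'0
    refine ⟨c, ?_⟩
    have h1 : W.valuation (c' - algebraMap K N c) < W.valuation c' :=
      valuation_lt_of_lt_of_le hWW' hc
    have : a - algebraMap K N c = (a - c') + (c' - algebraMap K N c) := by ring
    rw [this]
    exact Valuation.map_add_lt _ hc' (hWa ▸ h1)

end Literature.AlgebraicGeometry.Resolution
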